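import Mathlib.Analysis.Calculus.InverseFunctionTheorem.ContDiff
import Mathlib.Analysis.Calculus.ContDiff.RCLike
import Mathlib.LinearAlgebra.FiniteDimensional.Lemmas
import Mathlib.Topology.Algebra.Module.FiniteDimension
import HarnessLib

/-!
# A hypersurface as a graph over another along a transversal direction

Pure calculus (inverse function theorem) in support of the comparison of touching hypersurfaces
(`Literature.Geometry.Lorentzian.TouchingSecondFundamentalForm`, layer L4 (b) of the proof
programme of `Literature.Geometry.Lorentzian.ChruscielEtAl2001_areaTheorem`).

Let `Φ : F → E` and `Φ' : F' → E` be `C^k` (`1 ≤ k < ∞`) parametrised hypersurfaces of a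
finite-dimensional space `E` through a common point `Φ m₀ = Φ' m₀'`, immersed there, and let `v`
be a vector transversal to both tangent spaces (`v ∉ range dΦ_{m₀}`, `v ∉ range dΦ'_{m₀'}`,
`dim F + 1 = dim E = dim F' + 1`). Then **near `m₀` the second hypersurface is a graph over the
first along the lines `τ ↦ Φ m + τ v`**: there are `f : F → ℝ` and `ρ : F → F'`, `C^k` near
`m₀`, with `f m₀ = 0`, `ρ m₀ = m₀'` and `Φ m + f m • v = Φ' (ρ m)` for `m` near `m₀`
(`exists_graph_along_transversal`). Proof: `H(m, τ) = Φ m + τ v` is a local diffeomorphism at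
`(m₀, 0)` (`hasFDerivAt_equiv_of_transversal`), giving adapted coordinates `(μ, T) = H⁻¹`;
`β = μ ∘ Φ'` is a local diffeomorphism at `m₀'`, `ρ = β⁻¹` and `f = T ∘ Φ' ∘ ρ`. This is the
standard first step of every tangency principle (Fontenele–Silva 2001, §1, (1.1): hypersurfaces
near a common point as graphs `x ↦ x + μ(x) η₀` over a common hyperplane; Eschenburg 1989, §2).

## References

* F. Fontenele, S. L. Silva, *A tangency principle and applications*, Illinois J. Math. 45
  (2001), §1, (1.1).
* J.-H. Eschenburg, *Maximum principle for hypersurfaces*, Manuscripta Math. 64 (1989), §2.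
-/

noncomputable section

open Set Filter Function Module

open scoped Topology ContDiff

namespace Literature.Analysis.Calculus

variable {E : Type*} [NormedAddCommGroup E] [NormedSpace ℝ E] [FiniteDimensional ℝ E]
  {F : Type*} [NormedAddCommGroup F] [NormedSpace ℝ F] [FiniteDimensional ℝ F]
  {F' : Type*} [NormedAddCommGroup F'] [NormedSpace ℝ F'] [FiniteDimensional ℝ F']

/-- **The derivative of `H(m, τ) = Φ m + τ v` is invertible when `v` is transversal**: if
`D : F →L E` is injective, `v ∉ range D` and `dim F + 1 = dim E`, then
`(m', τ') ↦ D m' + τ' • v` is a continuous linear equivalence `F × ℝ ≃L E`. [folklore] -/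
theorem bijective_of_transversal {D : F →L[ℝ] E} {v : E} (hinj : Injective D)
    (hv : v ∉ range D) (hdim : finrank ℝ F + 1 = finrank ℝ E) :
    Bijective (D.comp (ContinuousLinearMap.fst ℝ F ℝ) +
      (ContinuousLinearMap.snd ℝ F ℝ).smulRight v) := by
  set L := D.comp (ContinuousLinearMap.fst ℝ F ℝ) + (ContinuousLinearMap.snd ℝ F ℝ).smulRight v
    with hL
  have hLapply : ∀ q : F × ℝ, L q = D q.1 + q.2 • v := fun q ↦ by
    simp [hL]
  have hinjL : Injective L := by
    refine (injective_iff_map_eq_zero L).2 ?_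
    rintro ⟨m', τ'⟩ h
    have h' : D m' + τ' • v = 0 := by rw [← hLapply (m', τ')]; exact h
    by_cases hτ : τ' = 0
    · rw [hτ, zero_smul, add_zero] at h'
      have hm : m' = 0 := hinj (by rw [h', map_zero])
      rw [hm, hτ]
      rfl
    · exfalso
      apply hv
      refine ⟨-(τ'⁻¹ • m'), ?_⟩
      have : v = -(τ'⁻¹ • D m') := by
        have h2 : τ' • v = -D m' := eq_neg_of_add_eq_zero_right h'
        calc v = τ'⁻¹ • (τ' • v) := by rw [smul_smul, inv_mul_cancel₀ hτ, one_smul]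
          _ = -(τ'⁻¹ • D m') := by rw [h2, smul_neg]
      rw [this, map_neg, map_smul]
  refine ⟨hinjL, ?_⟩
  -- injective endomorphism between spaces of equal finite dimension
  have hdim' : finrank ℝ (F × ℝ) = finrank ℝ E := by
    rw [finrank_prod, finrank_self, hdim]
  exact (LinearMap.injective_iff_surjective_of_finrank_eq_finrank hdim').1 hinjL

/-- **A second hypersurface as a graph over the first along a transversal direction.** Let
`Φ : F → E`, `Φ' : F' → E` be `C^k` at `m₀`, `m₀'` (`1 ≤ k`, `k ≠ ∞`) with `Φ' m₀' = Φ m₀`,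
injective differentials there, `v` transversal to both (`v ∉ range dΦ`, `v ∉ range dΦ'`) and
`dim F + 1 = dim E`, `dim F' = dim F`. Then there are `f : F → ℝ`, `ρ : F → F'`, both `C^k` near
`m₀`, with `f m₀ = 0`, `ρ m₀ = m₀'`, and `Φ m + f m • v = Φ' (ρ m)` for all `m` near `m₀`.
(Fontenele–Silva 2001, §1, (1.1); inverse function theorem twice.) [cite: FonteneleSilva2001, §1, (1.1)] -/
theorem exists_graph_along_transversal {k : ℕ∞ω} (hk : 1 ≤ k) (hk' : k ≠ ∞)
    {Φ : F → E} {Φ' : F' → E} {m₀ : F} {m₀' : F'} {v : E}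
    (hΦ : ContDiffAt ℝ k Φ m₀) (hΦ' : ContDiffAt ℝ k Φ' m₀') (hpt : Φ' m₀' = Φ m₀)
    (hinj : Injective (fderiv ℝ Φ m₀)) (hinj' : Injective (fderiv ℝ Φ' m₀'))
    (hv : v ∉ range (fderiv ℝ Φ m₀)) (hv' : v ∉ range (fderiv ℝ Φ' m₀'))
    (hdim : finrank ℝ F + 1 = finrank ℝ E) (hdim' : finrank ℝ F' = finrank ℝ F) :
    ∃ f : F → ℝ, ∃ ρ : F → F', f m₀ = 0 ∧ ρ m₀ = m₀' ∧
      (∀ᶠ m in 𝓝 m₀, ContDiffAt ℝ k f m) ∧ (∀ᶠ m in 𝓝 m₀, ContDiffAt ℝ k ρ m) ∧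
      ∀ᶠ m in 𝓝 m₀, Φ m + f m • v = Φ' (ρ m) := by
  haveI : CompleteSpace E := FiniteDimensional.complete ℝ E
  haveI : CompleteSpace F := FiniteDimensional.complete ℝ F
  haveI : CompleteSpace F' := FiniteDimensional.complete ℝ F'
  have hk0 : k ≠ 0 := by
    intro h; rw [h] at hk; exact absurd hk (by norm_num)
  -- Step 1: `H(m, τ) = Φ m + τ v` is a local diffeomorphism at `(m₀, 0)`
  set H : F × ℝ → E := fun q ↦ Φ q.1 + q.2 • v with hH
  have hHc : ContDiffAt ℝ k H (m₀, 0) :=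
    (hΦ.comp (m₀, (0 : ℝ)) contDiffAt_fst).add (contDiffAt_snd.smul contDiffAt_const)
  set L₀ := (fderiv ℝ Φ m₀).comp (ContinuousLinearMap.fst ℝ F ℝ) +
    (ContinuousLinearMap.snd ℝ F ℝ).smulRight v with hL₀
  have hbij := bijective_of_transversal hinj hv hdim
  set L : (F × ℝ) ≃L[ℝ] E := ContinuousLinearEquiv.ofBijective L₀
    (LinearMap.ker_eq_bot.2 hbij.1) (LinearMap.range_eq_top.2 hbij.2) with hLdef
  have hLcoe : (L : F × ℝ →L[ℝ] E) = L₀ := ContinuousLinearEquiv.coe_ofBijective _ _ _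
  have hHd : HasFDerivAt H (L : F × ℝ →L[ℝ] E) (m₀, 0) := by
    rw [hLcoe, hL₀]
    have h1 : HasFDerivAt (fun q : F × ℝ ↦ Φ q.1)
        ((fderiv ℝ Φ m₀).comp (ContinuousLinearMap.fst ℝ F ℝ)) (m₀, 0) :=
      (hΦ.differentiableAt hk0).hasFDerivAt.comp (m₀, (0 : ℝ)) hasFDerivAt_fst
    have h2 : HasFDerivAt (fun q : F × ℝ ↦ q.2 • v)
        ((ContinuousLinearMap.snd ℝ F ℝ).smulRight v) (m₀, 0) :=
      hasFDerivAt_snd.smul_const v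
    exact h1.add h2
  have hHs := hHc.hasStrictFDerivAt' hHd hk0
  set Hinv := hHs.localInverse H L (m₀, 0) with hHinv
  have hleft : ∀ᶠ q in 𝓝 ((m₀, (0 : ℝ)) : F × ℝ), Hinv (H q) = q := hHs.eventually_left_inverse
  have hright : ∀ᶠ x in 𝓝 (H (m₀, 0)), H (Hinv x) = x := hHs.eventually_right_inverse
  have hH0 : H (m₀, 0) = Φ m₀ := by simp [hH]
  have hHinv0 : Hinv (Φ m₀) = (m₀, 0) := by
    rw [← hH0]; exact hHs.localInverse_apply_image
  have hHinvc : ContDiffAt ℝ k Hinv (Φ m₀) := by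
    rw [← hH0]; exact hHc.to_localInverse hHd hk0
  have hHinvd : HasFDerivAt Hinv ((L.symm : E ≃L[ℝ] F × ℝ) : E →L[ℝ] F × ℝ) (Φ m₀) := by
    rw [← hH0]; exact hHs.to_localInverse.hasFDerivAt
  -- Step 2: `β = μ ∘ Φ'` is a local diffeomorphism at `m₀'`, `μ = fst ∘ H⁻¹`
  set β : F' → F := fun m' ↦ (Hinv (Φ' m')).1 with hβ
  have hβc : ContDiffAt ℝ k β m₀' := by
    have h : ContDiffAt ℝ k Hinv (Φ' m₀') := by rw [hpt]; exact hHinvc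
    exact contDiffAt_fst.comp m₀' (h.comp m₀' hΦ')
  set B₀ : F' →L[ℝ] F := (ContinuousLinearMap.fst ℝ F ℝ).comp
    (((L.symm : E ≃L[ℝ] F × ℝ) : E →L[ℝ] F × ℝ).comp (fderiv ℝ Φ' m₀')) with hB₀
  have hβd : HasFDerivAt β B₀ m₀' := by
    have h : HasFDerivAt Hinv ((L.symm : E ≃L[ℝ] F × ℝ) : E →L[ℝ] F × ℝ) (Φ' m₀') := by
      rw [hpt]; exact hHinvd
    exact hasFDerivAt_fst.comp m₀' (h.comp m₀' (hΦ'.differentiableAt hk0).hasFDerivAt)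
  have hβinj : Injective B₀ := by
    refine (injective_iff_map_eq_zero B₀).2 ?_
    intro w hw
    have hw' : (L.symm (fderiv ℝ Φ' m₀' w)).1 = 0 := hw
    -- `dΦ' w = L (0, τ) = τ • v`
    set τ := (L.symm (fderiv ℝ Φ' m₀' w)).2 with hτ
    have hLs : L.symm (fderiv ℝ Φ' m₀' w) = (0, τ) := Prod.ext hw' rfl
    have hvw : fderiv ℝ Φ' m₀' w = τ • v := by
      have h := L.apply_symm_apply (fderiv ℝ Φ' m₀' w)
      rw [hLs] at h
      rw [← h]
      show L₀ (0, τ) = τ • v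
      simp [hL₀]
    by_cases hτ0 : τ = 0
    · rw [hτ0, zero_smul] at hvw
      exact hinj' (by rw [hvw, map_zero])
    · exfalso
      apply hv'
      refine ⟨τ⁻¹ • w, ?_⟩
      rw [map_smul]
      show τ⁻¹ • fderiv ℝ Φ' m₀' w = v
      rw [hvw, smul_smul, inv_mul_cancel₀ hτ0, one_smul]
  have hβbij : Bijective B₀ :=
    ⟨hβinj, (LinearMap.injective_iff_surjective_of_finrank_eq_finrank hdim').1 hβinj⟩
  set B : F' ≃L[ℝ] F := ContinuousLinearEquiv.ofBijective B₀
    (LinearMap.ker_eq_bot.2 hβbij.1) (LinearMap.range_eq_top.2 hβbij.2) with hBdef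
  have hBcoe : (B : F' →L[ℝ] F) = B₀ := ContinuousLinearEquiv.coe_ofBijective _ _ _
  have hβd' : HasFDerivAt β (B : F' →L[ℝ] F) m₀' := by rw [hBcoe]; exact hβd
  have hβs := hβc.hasStrictFDerivAt' hβd' hk0
  set ρ := hβs.localInverse β B m₀' with hρ
  have hβ0 : β m₀' = m₀ := by
    show (Hinv (Φ' m₀')).1 = m₀
    rw [hpt, hHinv0]
  have hρleft : ∀ᶠ m' in 𝓝 m₀', ρ (β m') = m' := hβs.eventually_left_inverse
  have hρright : ∀ᶠ m in 𝓝 (β m₀'), β (ρ m) = m := hβs.eventually_right_inverse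
  have hρ0 : ρ m₀ = m₀' := by rw [← hβ0]; exact hβs.localInverse_apply_image
  have hρc : ContDiffAt ℝ k ρ m₀ := by rw [← hβ0]; exact hβc.to_localInverse hβd' hk0
  have hρt : Tendsto ρ (𝓝 m₀) (𝓝 m₀') := by
    have h := hβs.localInverse_tendsto
    rw [hβ0] at h
    exact h
  -- Step 3: `f = T ∘ Φ' ∘ ρ`, `T = snd ∘ H⁻¹`
  set f : F → ℝ := fun m ↦ (Hinv (Φ' (ρ m))).2 with hf
  have hΦ'ρt : Tendsto (fun m ↦ Φ' (ρ m)) (𝓝 m₀) (𝓝 (Φ m₀)) := by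
    have h : ContinuousAt Φ' m₀' := hΦ'.continuousAt
    have h' : Tendsto Φ' (𝓝 m₀') (𝓝 (Φ m₀)) := by rw [← hpt]; exact h
    exact h'.comp hρt
  refine ⟨f, ρ, ?_, hρ0, ?_, ?_, ?_⟩
  · show (Hinv (Φ' (ρ m₀))).2 = 0
    rw [hρ0, hpt, hHinv0]
  · -- `f` is `C^k` near `m₀`
    have hev : ∀ᶠ m in 𝓝 m₀, ContDiffAt ℝ k (fun m ↦ Hinv (Φ' (ρ m))) m := by
      have h1 : ContDiffAt ℝ k (fun m ↦ Hinv (Φ' (ρ m))) m₀ := by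
        have hH' : ContDiffAt ℝ k Hinv (Φ' (ρ m₀)) := by rw [hρ0, hpt]; exact hHinvc
        have hΦ'' : ContDiffAt ℝ k Φ' (ρ m₀) := by rw [hρ0]; exact hΦ'
        exact hH'.comp m₀ (hΦ''.comp m₀ hρc)
      exact h1.eventually hk'
    exact hev.mono fun m hm ↦ contDiffAt_snd.comp m hm
  · exact hρc.eventually hk'
  · -- the graph identity
    have hright' : ∀ᶠ m in 𝓝 m₀, H (Hinv (Φ' (ρ m))) = Φ' (ρ m) := by
      have h : ∀ᶠ x in 𝓝 (Φ m₀), H (Hinv x) = x := by rw [← hH0]; exact hright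
      exact hΦ'ρt.eventually h
    have hρright' : ∀ᶠ m in 𝓝 m₀, β (ρ m) = m := by rw [← hβ0]; exact hρright
    filter_upwards [hright', hρright'] with m hm hβm
    -- `H (μ c, T c) = c` with `μ c = β (ρ m) = m`, `T c = f m`
    have hμ : (Hinv (Φ' (ρ m))).1 = m := hβm
    have h := hm
    simp only [hH] at h
    rw [hμ] at h
    exact h

end Literature.Analysis.Calculus

end
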